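import Literature.AlgebraicGeometry.AbelianSchemes.FibreHomPointsOfFibrePoints
import HarnessLib

/-!
# Transport of a fibre READING along a leg of the base and a pair of fibre isomorphisms over one point of a common target
# ([GortzWedhorn2020] (4.7) base change and fibres; [MumfordFogartyKirwan1994] Ch. 6 §2 Def. 6.3)

Topic `Literature/AlgebraicGeometry/AbelianSchemes`; namespace `Literature.AlgebraicGeometry.AbelianSchemes.AbelianSchemeOver`.  THEOREMS ONLY (no definition, no named
fact, no instance, no notation, no `sorry`).  Cell `hodgecm-mathlib` (D-0151), FLOOR 0, P6 «MOD» (crux hLiu418 = stmt-HodgeConjecture-24832, `--supports`), organ **RD-X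
«READING TRANSPORT»** of the E6 closer of `Cruxes/HLiu418/Lines/F0_P6a_PELWitnessE.lean` (socket Σ-AN `ReadsCReading`, last in-context step RD-4; E6 heir A-p06 (g33)):
the per-piece endomorphism `Y_q` of `P_{X_q}.A` reads the lattice matrix through the admissible marking of its fibres (★ PIECES `exists_isMonHom_reads_of_piece`), the
glued endomorphism `Y` of `P.A ×_X X_ℂ` restricts to a conjugate of `Y_q` on the leg `X_q → X_ℂ` (★ ASM (a)∕(b)), and the marking was moved from `P_{X_q}` at the
analytic point to `P` at the complex point through the fibre of the universal family (★ RD-T3: `toFun ↦ e₂⁻¹ ∘ e₁ ∘ toFun`); this file is the bookkeeping that turns the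
three into the total-space reading equation of `ReadsCReading`.  Everything is compared AFTER PUSHING FIBRE POINTS INTO THE COMMON TARGET `Q` (the universal abelian
scheme), where all the maps involved commute with the projections.  HC_CM is proved only modulo the printed citations (2 remaining named inputs hLiu418 24832, h413
24833) until rung 0 closes; this file is generic and changes no count.

THE MATHEMATICS.  `Q → M` an abelian scheme (the universal one), `A₂ → X` and `A₁ → T` abelian schemes with morphisms `G₂ : A₂ → Q`, `G₁ : A₁ → Q` of total spaces
(the pull-back projections), `pr : X_c → X`, a leg `ι : T → X_c`, an isomorphism of `T`-group schemes `e_T : (A₂ ×_X X_c) ×_{X_c} T ≅ A₁` over `Q`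
(`e_T ≫ G₁ = pr₁ ≫ pr₁ ≫ G₂`), endomorphisms `Y` of `A₂ ×_X X_c` and `Y₁` of `A₁` with `Y|_T ≫ e_T = e_T ≫ Y₁`; points `t₀` of `T`, `x = t₀ ≫ ι ≫ pr` of `X`, `p` of `M`,
and fibre isomorphisms `e₁ : (A₁)_{t₀} ≅ Q_p`, `e₂ : (A₂)_x ≅ Q_p` over `G₁`, `G₂` on points.  If `Y₁` maps the fibre point `P₁` to `P₁′`, then `Y` maps the point of
`A₂ ×_X X_c` over `(e₂⁻¹ e₁ P₁, t₀ ≫ ι)` to the point over `e₂⁻¹ e₁ P₁′` — because the point of `Q` under each is `G₁ (Y₁ P₁)`, and a fibre point of `A₂` at `x` is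
determined by its point of `Q` ([GortzWedhorn2020] (4.7.1): `Hom_S(Spec Ω, A) = (A ×_S Spec Ω)(Ω)`, fibres of a cartesian square).

* §1 `eq_of_fibrePointToLeft_comp_eq` — a fibre point is determined by its image in `Q` (given a fibre isomorphism over `G`); `exists_fibrePoint_of_comp_hom_eq`.
* §2 **`fibre_reading_transport_along_leg`** — THE HEAD.

## References
* [GortzWedhorn2020] U. Görtz, T. Wedhorn, *Algebraic Geometry I*, 2nd ed. (2020), Section (4.7), (4.7.1) (p. 108) and Prop. 4.16 (p. 101).
* [MumfordFogartyKirwan1994] D. Mumford, J. Fogarty, F. Kirwan, *Geometric Invariant Theory*, 3rd ed. (1994), Ch. 6 §2 Definition 6.3 (p. 120).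
-/

set_option autoImplicit false

noncomputable section

open CategoryTheory CategoryTheory.Limits AlgebraicGeometry

universe u

namespace Literature.AlgebraicGeometry.AbelianSchemes.AbelianSchemeOver

open Literature.AlgebraicGeometry.Motives

/-! ### §1 Fibre points are determined by their image in the common target -/

/-- **A fibre point is determined by its image in `Q`**: if `e : A_s ≅ Q_p` is a fibre isomorphism OVER `G : A → Q` on points (`Q.pt (e P) = A.pt P ≫ G`), then
`P ↦ A.pt P ≫ G` is injective (`e` is a bijection on points and ★ `fibrePointToLeft_injective` for `Q`). [cite: GortzWedhorn2020, Section (4.7), (4.7.1) (p. 108)] -/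
theorem eq_of_fibrePointToLeft_comp_eq {M S : Scheme.{u}} (Q : AbelianSchemeOver M) (A : AbelianSchemeOver S) (G : A.X.left ⟶ Q.X.left)
    {Ω : Type u} [Field Ω] {s : Spec (.of Ω) ⟶ S} {p : Spec (.of Ω) ⟶ M}
    (e : (A.fibre s).toAbelianVariety ≅ (Q.fibre p).toAbelianVariety)
    (he : ∀ P, Q.fibrePointToLeft p (AlgPoints.map e.hom.hom.hom.hom P) = A.fibrePointToLeft s P ≫ G)
    {P P' : (A.fibre s).toAbelianVariety.Points Ω} (h : A.fibrePointToLeft s P ≫ G = A.fibrePointToLeft s P' ≫ G) : P = P' := by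
  have h1 : AlgPoints.map e.hom.hom.hom.hom P = AlgPoints.map e.hom.hom.hom.hom P' :=
    Q.fibrePointToLeft_injective p (by rw [he, he, h])
  have h2 := congrArg (AlgPoints.map e.inv.hom.hom.hom) h1
  have hid : e.hom.hom.hom.hom ≫ e.inv.hom.hom.hom = 𝟙 _ := by
    change (e.hom ≫ e.inv).hom.hom.hom = _
    rw [Iso.hom_inv_id]
    rfl
  rwa [← AlgPoints.map_comp_apply, ← AlgPoints.map_comp_apply, hid, AlgPoints.map_id_apply, AlgPoints.map_id_apply] at h2

/-- Every point `z : Spec Ω → A` over `s` is the point of `A` under an `Ω`-point of the fibre `A_s` (★ `exists_points_fibrePointToLeft_eq`).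
[cite: GortzWedhorn2020, Section (4.7), (4.7.1) (p. 108)] -/
theorem exists_fibrePoint_of_comp_hom_eq {S : Scheme.{u}} (A : AbelianSchemeOver S) {Ω : Type u} [Field Ω] {s : Spec (.of Ω) ⟶ S}
    (z : Spec (.of Ω) ⟶ A.X.left) (hz : z ≫ A.X.hom = s) :
    ∃ P : (A.fibre s).toAbelianVariety.Points Ω, A.fibrePointToLeft s P = z :=
  A.exists_points_fibrePointToLeft_eq s (Over.homMk z hz : A.FibrePoints s)

/-! ### §2 HEAD: the reading equation moves along the leg -/

/-- **READING TRANSPORT ALONG A LEG.**  `Q → M`, `A₂ → X`, `A₁ → T` abelian schemes, `G₂ : A₂ → Q`, `G₁ : A₁ → Q`, `pr : X_c → X`, a leg `ι : T → X_c`, an isomorphism of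
`T`-group schemes `e_T : (A₂ ×_X X_c) ×_{X_c} T ≅ A₁` OVER `Q` (`heT`), endomorphisms `Y` of `A₂ ×_X X_c` and `Y₁` of `A₁` intertwined by `e_T` (`hY`), a point `t₀` of
`T` with `t₀ ≫ ι ≫ pr = x`, fibre isomorphisms `e₁ : (A₁)_{t₀} ≅ Q_p`, `e₂ : (A₂)_x ≅ Q_p` over `G₁`, `G₂` on points.  If `Y₁` maps the fibre point `P₁` to `P₁′`
(`(Y₁)_{t₀} P₁ = P₁′`, the ★ PIECES reading), then for every point `q` of the total space `A₂ ×_X X_c` lying over the fibre point `e₂⁻¹ (e₁ P₁)` of `A₂` at `x` and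
over `t₀ ≫ ι` in `X_c`, the point `q ≫ Y` lies over `e₂⁻¹ (e₁ P₁′)` — the total-space reading clause of `ReadsCReading` from the piece-level one.
[cite: GortzWedhorn2020, Section (4.7), (4.7.1) (p. 108) and Prop. 4.16 (p. 101)] [cite: MumfordFogartyKirwan1994, Ch. 6 §2 Definition 6.3 (p. 120)] -/
theorem fibre_reading_transport_along_leg {M X Xc T : Scheme.{u}} (Q : AbelianSchemeOver M) (A₂ : AbelianSchemeOver X) (A₁ : AbelianSchemeOver T)
    (G₂ : A₂.X.left ⟶ Q.X.left) (G₁ : A₁.X.left ⟶ Q.X.left) (pr : Xc ⟶ X) (ι : T ⟶ Xc)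
    (eT : ((A₂.baseChange pr).baseChange ι).X ≅ A₁.X) [IsMonHom eT.hom]
    (heT : eT.hom.left ≫ G₁ =
      pullback.fst (pullback.snd A₂.X.hom pr) ι ≫ pullback.fst A₂.X.hom pr ≫ G₂)
    (Y : (A₂.baseChange pr).X ⟶ (A₂.baseChange pr).X) [IsMonHom Y] (Y₁ : A₁.X ⟶ A₁.X) [IsMonHom Y₁]
    (hY : (Over.pullback ι).map Y ≫ eT.hom = eT.hom ≫ Y₁)
    {Ω : Type u} [Field Ω] {t₀ : Spec (.of Ω) ⟶ T} {x : Spec (.of Ω) ⟶ X} {p : Spec (.of Ω) ⟶ M} (hx : t₀ ≫ ι ≫ pr = x)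
    (e₁ : (A₁.fibre t₀).toAbelianVariety ≅ (Q.fibre p).toAbelianVariety)
    (he₁ : ∀ P, Q.fibrePointToLeft p (AlgPoints.map e₁.hom.hom.hom.hom P) = A₁.fibrePointToLeft t₀ P ≫ G₁)
    (e₂ : (A₂.fibre x).toAbelianVariety ≅ (Q.fibre p).toAbelianVariety)
    (he₂ : ∀ P, Q.fibrePointToLeft p (AlgPoints.map e₂.hom.hom.hom.hom P) = A₂.fibrePointToLeft x P ≫ G₂)
    {P₁ P₁' : (A₁.fibre t₀).toAbelianVariety.Points Ω} (hread : AlgPoints.map (fibreHom Y₁ t₀).hom.hom.hom P₁ = P₁')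
    (q : Spec (.of Ω) ⟶ pullback A₂.X.hom pr)
    (hq₁ : q ≫ pullback.fst A₂.X.hom pr =
      A₂.fibrePointToLeft x (AlgPoints.map e₂.inv.hom.hom.hom (AlgPoints.map e₁.hom.hom.hom.hom P₁)))
    (hq₂ : q ≫ pullback.snd A₂.X.hom pr = t₀ ≫ ι) :
    (q ≫ Y.left) ≫ pullback.fst A₂.X.hom pr =
      A₂.fibrePointToLeft x (AlgPoints.map e₂.inv.hom.hom.hom (AlgPoints.map e₁.hom.hom.hom.hom P₁')) := by
  -- `e₂ (e₂⁻¹ R) = R` on points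
  have hinv : ∀ R : (Q.fibre p).toAbelianVariety.Points Ω,
      AlgPoints.map e₂.hom.hom.hom.hom (AlgPoints.map e₂.inv.hom.hom.hom R) = R := fun R => by
    have hid : e₂.inv.hom.hom.hom ≫ e₂.hom.hom.hom.hom = 𝟙 _ := by
      change (e₂.inv ≫ e₂.hom).hom.hom.hom = _
      rw [Iso.inv_hom_id]
      rfl
    rw [← AlgPoints.map_comp_apply, hid, AlgPoints.map_id_apply]
  -- the image in `Q` of the transported points: `A₂.pt (e₂⁻¹ e₁ R) ≫ G₂ = A₁.pt R ≫ G₁`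
  have hpush : ∀ R : (A₁.fibre t₀).toAbelianVariety.Points Ω,
      A₂.fibrePointToLeft x (AlgPoints.map e₂.inv.hom.hom.hom (AlgPoints.map e₁.hom.hom.hom.hom R)) ≫ G₂ =
        A₁.fibrePointToLeft t₀ R ≫ G₁ := fun R => by
    rw [← he₂, hinv, he₁]
  -- clean-typed names for the total spaces
  let E : pullback (pullback.snd A₂.X.hom pr) ι ⟶ A₁.X.left := eT.hom.left
  let Yl : pullback A₂.X.hom pr ⟶ pullback A₂.X.hom pr := Y.left
  have hYl : Yl ≫ pullback.snd A₂.X.hom pr = pullback.snd A₂.X.hom pr := Over.w Y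
  -- the point of the leg total space under `q`
  let qT : Spec (.of Ω) ⟶ pullback (pullback.snd A₂.X.hom pr) ι := pullback.lift q t₀ hq₂
  have hqT₁ : qT ≫ pullback.fst (pullback.snd A₂.X.hom pr) ι = q := pullback.lift_fst _ _ _
  have hqT₂ : qT ≫ pullback.snd (pullback.snd A₂.X.hom pr) ι = t₀ := pullback.lift_snd _ _ _
  -- `z₁ := e_T (qT)` is the point of `A₁` under `P₁`
  have hz₁_over : (qT ≫ E) ≫ A₁.X.hom = t₀ := by
    have hw : E ≫ A₁.X.hom = pullback.snd (pullback.snd A₂.X.hom pr) ι := Over.w eT.hom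
    rw [Category.assoc, hw, hqT₂]
  obtain ⟨R₁, hR₁⟩ := A₁.exists_fibrePoint_of_comp_hom_eq (qT ≫ E) hz₁_over
  have hEG : E ≫ G₁ = pullback.fst (pullback.snd A₂.X.hom pr) ι ≫ pullback.fst A₂.X.hom pr ≫ G₂ := heT
  have hR₁G : A₁.fibrePointToLeft t₀ R₁ ≫ G₁ = A₁.fibrePointToLeft t₀ P₁ ≫ G₁ :=
    calc A₁.fibrePointToLeft t₀ R₁ ≫ G₁ = qT ≫ (E ≫ G₁) := by rw [hR₁, Category.assoc]
      _ = (qT ≫ pullback.fst (pullback.snd A₂.X.hom pr) ι) ≫ pullback.fst A₂.X.hom pr ≫ G₂ := by rw [hEG, Category.assoc]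
      _ = (q ≫ pullback.fst A₂.X.hom pr) ≫ G₂ := by rw [hqT₁, Category.assoc]
      _ = A₁.fibrePointToLeft t₀ P₁ ≫ G₁ := by rw [hq₁, hpush]
  have hR₁eq : R₁ = P₁ := eq_of_fibrePointToLeft_comp_eq Q A₁ G₁ e₁ he₁ hR₁G
  -- the restricted endomorphism on the leg: `Y|_T ≫ e_T = e_T ≫ Y₁` read after `qT`, and `Y|_T` over the first projection
  let Ml : pullback (pullback.snd A₂.X.hom pr) ι ⟶ pullback (pullback.snd A₂.X.hom pr) ι :=
    ((Over.pullback ι).map Y).left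
  have hres : qT ≫ Ml ≫ E = qT ≫ E ≫ Y₁.left := by
    have h := congrArg CommaMorphism.left hY
    simp only [Over.comp_left] at h
    exact congrArg (fun φ => qT ≫ φ) h
  have hres' : Ml ≫ pullback.fst (pullback.snd A₂.X.hom pr) ι =
      pullback.fst (pullback.snd A₂.X.hom pr) ι ≫ Yl := by
    show ((Over.pullback ι).map Y).left ≫ _ = _
    simp only [Over.pullback_map_left]
    erw [pullback.lift_fst]
    rfl
  -- `q ≫ Y` pushed to `Q`: `((q ≫ Y) ≫ pr₁) ≫ G₂ = (A₁.pt P₁ ≫ Y₁) ≫ G₁`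
  have k2 : ((q ≫ Yl) ≫ pullback.fst A₂.X.hom pr) ≫ G₂ = (A₁.fibrePointToLeft t₀ P₁ ≫ Y₁.left) ≫ G₁ := by
    rw [← hqT₁]
    conv_lhs => simp only [Category.assoc]
    rw [← reassoc_of% hres', ← hEG, reassoc_of% hres, ← Category.assoc qT E, ← hR₁, hR₁eq]
    exact (Category.assoc _ _ _).symm
  -- the point of `A₂` under `q ≫ Y` lies over `x`
  have hYover : ((q ≫ Yl) ≫ pullback.fst A₂.X.hom pr) ≫ A₂.X.hom = x := by
    rw [Category.assoc, Category.assoc, pullback.condition, ← Category.assoc Yl, hYl, ← Category.assoc, hq₂, Category.assoc, hx]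
  obtain ⟨R₂, hR₂⟩ := A₂.exists_fibrePoint_of_comp_hom_eq ((q ≫ Yl) ≫ pullback.fst A₂.X.hom pr) hYover
  have hR₂eq : R₂ = AlgPoints.map e₂.inv.hom.hom.hom (AlgPoints.map e₁.hom.hom.hom.hom P₁') := by
    refine eq_of_fibrePointToLeft_comp_eq Q A₂ G₂ e₂ he₂ ?_
    rw [hR₂, hpush P₁', ← hread, fibrePointToLeft_map_fibreHom, k2]
  rw [← hR₂eq, hR₂]
  rfl

end Literature.AlgebraicGeometry.AbelianSchemes.AbelianSchemeOver


end
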